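import Literature.Barriers.CriticalPhenomena.RigorousRGSmallParameterLocDuality
import HarnessLib

/-!
# `RigorousRGSmallParameter` (Slade, Theorem 1.4.1): pairings of local monomials at the points of
# a coordinate patch with the binomial test functions — the "triangularity kernel" of
# Lemma 2.1.5 of [BS-rg-loc]

Companion ("proof architecture") file of
`Literature/Barriers/CriticalPhenomena/RigorousRGSmallParameter.lean`, continuing `…LocDuality`.
The localisation operator `Loc_X` of [BS-rg-loc] (Definition 1.3.2; Slade §4.2) is built from
the matrix `B_{m',m} = ⟨P̂_{m'}(X), f_m^{(a)}⟩_0` of Lemma 2.1.5, whose invertibility rests on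
"`B_{m',m} = |X|δ_{m',m}` for `[M_{m'}] ≥ [M_m]`": pairings of monomials `M_{m'',x}` located at
the points `x ∈ X` of the patch around `a` (with signed multi-indices, as produced by the
symmetrisation `P̂`) with the binomial test functions `b_m^{(a)}` based at `a`. This file proves
the two facts behind that display, for the concrete model on the torus `TorusSite d M`:

* **(A)** if `m''` carries more derivatives than the degree of `b_m` (`Σ|α''_k| > Σ|α_k|`), then
  `⟨M_{m'',x}, b_m^{(a)}⟩_0 = 0` for every `x` in the patch;
* **(B)** if the total orders and the degrees agree, `⟨M_{m'',x}, b_m^{(a)}⟩_0` is INDEPENDENT of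
  `x`: it equals `(1/p!)·(-1)^{#backward steps of m''}·pcountS(m'', m)`, the pattern permanent
  comparing the (component, axes) classes of the factors.

Both follow from the permanent formula of `…LocDuality` and the signed finite-difference calculus
of the binomial polynomials `binom(z, t)` (`Ring.choose` over `ℤ`): `∇^{e}binom(r,s) = binom(r,s-1)`,
`∇^{-e}binom(r,s) = -binom(r-1,s-1)`, at the points `a + v`, `v ∈ ℤ^d`, of the patch (no
wrapping: `2(|v_j| + |α|) < M`).

Sources: D. C. Brydges, G. Slade, *A renormalisation group method. II. Approximation by local
polynomials*, J. Stat. Phys. 159 (2015) 461–491, arXiv:1403.7253 (read from the TeX source: §1.3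
(coordinates), §2.1 (Lemma 2.1.5 and its proof), §3.2).

## What this file provides (definitions with proved properties; no named fact)

* `offsetPtZ` (`a + v`, `v ∈ ℤ^d`), `coord_offsetPtZ`, `offsetPtZ_add_unitStep`, `offsetPtZ_coord`;
  `axisCnt`, `backCnt`, `sgnB` (`(-1)^{#back}`), `sgnB_mul_self`, `sum_axisCnt`, `sum_count_dir`.
* **`fdiffs_multiBinomZ`** (signed differences of `∏_j binom(z_j,t_j)`), `rowC_offsetPtZ_binomTF`,
  `clsS` (axis classes), `clsS_fwd`, `length_eq_of_clsS_eq_cls`, **(E1)**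
  `rowC_offsetPtZ_binomTF_eq_zero_of_lt`, **(E2)** `rowC_offsetPtZ_binomTF_of_eq`.
* `tordS`/`tordF` (total orders), `sgnM`, `pcountS`, `tordF_eraseIdx_add`, **(L-A)**
  `lperm_offsetPtZ_eq_zero_of_lt`, **(L-B)** `lperm_offsetPtZ_of_eq`, and the pairing forms
  **`TphiPairing_monomial_offsetPtZ_eq_zero`** (A), **`TphiPairing_monomial_offsetPtZ_of_eq`** (B),
  `pcountS_fwd`.

## References

* [BrydgesSlade2015RGII] D. C. Brydges, G. Slade, *A renormalisation group method. II.
  Approximation by local polynomials*, J. Stat. Phys. 159 (2015) 461–491, arXiv:1403.7253 —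
  §1.3, §2.1 (Lemma 2.1.5), §3.2.
* [Slade2017] G. Slade, *Critical exponents for long-range O(n) models below the upper critical
  dimension*, Commun. Math. Phys. 358 (2018) 343–436, arXiv:1611.06169 — §4.2 (Loc).
-/

noncomputable section

namespace Literature.Barriers.CriticalPhenomena

namespace LongRangePhi4

namespace Loc

open Finset Tphi RGNorm LocalPoly Literature.Probability.LatticeModels
open scoped ContDiff

variable {d M n : ℕ} [NeZero M]

/-! ### Signed offsets in the patch around `a` -/

/-- The point `a + v` for a signed offset `v ∈ ℤ^d`. [folklore] -/
def offsetPtZ (a : TorusSite d M) (v : Fin d → ℤ) : TorusSite d M := fun j => a j + ((v j : ℤ) : ZMod M)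

omit [NeZero M] in
/-- `a + 0 = a`. [folklore] -/
@[simp] theorem offsetPtZ_zero (a : TorusSite d M) : offsetPtZ a (fun _ => 0) = a := by
  funext j; simp [offsetPtZ]

omit [NeZero M] in
/-- `(a + v) ± e_j = a + (v ± δ_j)`. [folklore] -/
theorem offsetPtZ_add_unitStep (a : TorusSite d M) (v : Fin d → ℤ) (s : Fin d × Bool) :
    offsetPtZ a v + unitStep d M s = offsetPtZ a (v + Pi.single s.1 (if s.2 then 1 else -1)) := by
  funext j'
  simp only [offsetPtZ, unitStep, Pi.add_apply]
  by_cases h : j' = s.1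
  · subst h
    cases s.2 <;> simp <;> ring
  · simp [h]

/-- Inside the patch the coordinate of `a + v` is `v`: `z_j(a+v) = v_j` when `2|v_j| < M`. [folklore] -/
theorem coord_offsetPtZ (a : TorusSite d M) {v : Fin d → ℤ} {j : Fin d} (hv : 2 * |v j| < M) :
    coord a (offsetPtZ a v) j = v j := by
  simp only [coord, offsetPtZ, add_sub_cancel_left]
  rw [ZMod.valMinAbs_spec]
  refine ⟨rfl, ?_, ?_⟩
  · have := neg_abs_le (v j); omega
  · have := le_abs_self (v j); omega

omit [NeZero M] in
/-- Every point is `a +` its coordinate vector. [folklore] -/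
theorem offsetPtZ_coord (a x : TorusSite d M) : offsetPtZ a (fun j => coord a x j) = x := by
  funext j
  simp [offsetPtZ, coord, ZMod.coe_valMinAbs]

/-! ### Signed differences of the multi-binomials -/

/-- The number of steps of `α` along the axis `j` (either sign). [folklore] -/
def axisCnt (α : List (Fin d × Bool)) (j : Fin d) : ℕ := (α.map Prod.fst).count j

/-- The number of backward steps `-e_j` in `α`. [folklore] -/
def backCnt (α : List (Fin d × Bool)) (j : Fin d) : ℕ := α.count (j, false)

/-- The sign `(-1)^{number of backward steps}` of `α`. [folklore] -/
def sgnB (α : List (Fin d × Bool)) : ℝ := (α.map fun s => if s.2 then (1 : ℝ) else -1).prod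

omit [NeZero M] in
/-- `sgnB` is `±1`; in particular `sgnB α * sgnB α = 1`. [folklore] -/
theorem sgnB_mul_self : ∀ α : List (Fin d × Bool), sgnB α * sgnB α = 1
  | [] => by simp [sgnB]
  | s :: α => by
      have ih := sgnB_mul_self α
      simp only [sgnB, List.map_cons, List.prod_cons] at ih ⊢
      cases s.2 <;> simp <;> linarith [ih]

/-- **Signed differences of the multi-binomial** `B_t(x) = ∏_j binom(z_j(x), t_j)`: at `a + v`,
`∇^α B_t = (-1)^{#back}·∏_j binom(v_j - back_j, t_j - cnt_j)` if `cnt ≤ t`, else `0`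
(`∇^{e} binom(r,s) = binom(r,s-1)`, `∇^{-e}binom(r,s) = -binom(r-1,s-1)`), inside the patch. [folklore] -/
theorem fdiffs_multiBinomZ (a : TorusSite d M) (t : Fin d → ℕ) :
    ∀ (α : List (Fin d × Bool)) (v : Fin d → ℤ), (∀ j, 2 * (|v j| + α.length) < M) →
    fdiffs (α.map (unitStep d M)) (fun x => ∏ j : Fin d, ((Ring.choose (coord a x j) (t j) : ℤ) : ℝ))
        (offsetPtZ a v) =
      sgnB α * (if ∀ j, axisCnt α j ≤ t j then
        ∏ j : Fin d, ((Ring.choose (v j - backCnt α j) (t j - axisCnt α j) : ℤ) : ℝ) else 0)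
  | [], v, hv => by
      simp only [List.map_nil, fdiffs_nil, sgnB, List.prod_nil, one_mul, axisCnt, List.count_nil,
        zero_le, implies_true, if_true, backCnt, Nat.cast_zero, sub_zero, Nat.sub_zero]
      refine Finset.prod_congr rfl fun j _ => ?_
      rw [coord_offsetPtZ a (by have := hv j; omega)]
  | s :: α, v, hv => by
      obtain ⟨j₀, b⟩ := s
      rw [List.map_cons, fdiffs_cons]
      simp only []
      have hv1 : ∀ j, 2 * (|(v + Pi.single j₀ (if b then 1 else -1) : Fin d → ℤ) j| + α.length) < M := by
        intro j
        have := hv j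
        simp only [List.length_cons, Nat.cast_add, Nat.cast_one, Pi.add_apply] at this ⊢
        by_cases h : j = j₀
        · subst h
          cases b <;> simp <;> cases abs_cases (v j) <;> cases abs_cases (v j + 1) <;>
            cases abs_cases (v j + -1) <;> omega
        · simp [h]; omega
      have hv0 : ∀ j, 2 * (|v j| + α.length) < M := fun j => by
        have := hv j; simp only [List.length_cons, Nat.cast_add, Nat.cast_one] at this; omega
      rw [offsetPtZ_add_unitStep, fdiffs_multiBinomZ a t α _ hv1, fdiffs_multiBinomZ a t α v hv0]
      -- bookkeeping of the counters for `s = (j₀, b)`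
      have hax : ∀ j, axisCnt ((j₀, b) :: α) j = axisCnt α j + if j₀ = j then 1 else 0 := by
        intro j; simp [axisCnt, List.count_cons]
      have hback : ∀ j, backCnt ((j₀, b) :: α) j = backCnt α j + if (j₀, b) = (j, false) then 1 else 0 := by
        intro j; simp [backCnt, List.count_cons]
      have hsgn : sgnB ((j₀, b) :: α) = (if b then 1 else -1) * sgnB α := by simp [sgnB]
      by_cases hcond : ∀ j, axisCnt α j ≤ t j
      · rw [if_pos hcond, if_pos hcond, ← mul_sub]
        rw [← Finset.mul_prod_erase _ _ (Finset.mem_univ j₀), ← Finset.mul_prod_erase _ _ (Finset.mem_univ j₀)]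
        have hrest : ∏ j ∈ Finset.univ.erase j₀,
            ((Ring.choose ((v + Pi.single j₀ (if b then 1 else -1) : Fin d → ℤ) j - backCnt α j) (t j - axisCnt α j) : ℤ) : ℝ) =
            ∏ j ∈ Finset.univ.erase j₀, ((Ring.choose (v j - backCnt α j) (t j - axisCnt α j) : ℤ) : ℝ) := by
          refine Finset.prod_congr rfl fun j hj => ?_
          rw [Finset.mem_erase] at hj
          simp [hj.1]
        rw [hrest, ← sub_mul]
        have hj0 : (v + Pi.single j₀ (if b then 1 else -1) : Fin d → ℤ) j₀ = v j₀ + if b then 1 else -1 := by simp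
        rw [hj0]
        set R : ℝ := ∏ j ∈ Finset.univ.erase j₀, ((Ring.choose (v j - backCnt α j) (t j - axisCnt α j) : ℤ) : ℝ) with hR
        by_cases hs : axisCnt α j₀ + 1 ≤ t j₀
        · -- the new condition holds; Pascal in direction `j₀`
          have hcond' : ∀ j, axisCnt ((j₀, b) :: α) j ≤ t j := by
            intro j; rw [hax]
            by_cases h : j₀ = j
            · subst h; simpa using hs
            · rw [if_neg h, add_zero]; exact hcond j
          rw [hsgn, if_pos hcond', ← Finset.mul_prod_erase _ _ (Finset.mem_univ j₀)]
          have hrest' : ∏ j ∈ Finset.univ.erase j₀,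
              ((Ring.choose (v j - backCnt ((j₀, b) :: α) j) (t j - axisCnt ((j₀, b) :: α) j) : ℤ) : ℝ) = R := by
            refine Finset.prod_congr rfl fun j hj => ?_
            rw [Finset.mem_erase] at hj
            rw [hax, hback]
            simp [Ne.symm hj.1]
          rw [hrest', hax, hback]
          simp only [if_true, Prod.mk.injEq, true_and]
          obtain ⟨u', hu'⟩ : ∃ u', t j₀ - axisCnt α j₀ = u' + 1 := ⟨t j₀ - axisCnt α j₀ - 1, by omega⟩
          have hu2 : t j₀ - (axisCnt α j₀ + 1) = u' := by omega
          rw [hu', hu2]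
          cases b
          · -- backward step: `binom(r-1, u'+1) - binom(r, u'+1) = -binom(r-1, u')`
            simp only [Bool.false_eq_true, if_false, if_true, Nat.cast_add, Nat.cast_one]
            have key : (v j₀ : ℤ) - (backCnt α j₀ : ℤ) = (v j₀ + -1 - backCnt α j₀) + 1 := by ring
            have hP := Ring.choose_succ_succ ((v j₀ : ℤ) + -1 - backCnt α j₀) u'
            rw [← key] at hP
            rw [hP]
            push_cast
            ring
          · -- forward step: `binom(r+1, u'+1) - binom(r, u'+1) = binom(r, u')`
            simp only [if_true, Bool.true_eq_false, if_false, add_zero]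
            have key : (v j₀ : ℤ) + 1 - (backCnt α j₀ : ℤ) = (v j₀ - backCnt α j₀) + 1 := by ring
            rw [key, Ring.choose_succ_succ]
            push_cast
            ring
        · -- `u = 0`: the difference vanishes and the new condition fails
          have hu0 : t j₀ - axisCnt α j₀ = 0 := by have := hcond j₀; omega
          have hcond' : ¬ ∀ j, axisCnt ((j₀, b) :: α) j ≤ t j := fun h => hs (by
            have := h j₀; rw [hax, if_pos rfl] at this; exact this)
          rw [if_neg hcond', hu0]
          cases b <;> simp
      · have hcond' : ¬ ∀ j, axisCnt ((j₀, b) :: α) j ≤ t j := fun h => hcond fun j => by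
          have := h j; rw [hax] at this; omega
        simp only [if_neg hcond, if_neg hcond', mul_zero, sub_zero]

/-- **Single contractions at another point of the patch**: for a signed factor `c'' = (i'', α'')`
contracted at `x = a + v` against the binomial one-point function `b_{(i,α)}^{(a)}`,
`r^{(x)}_{c''}(b_{(i,α)}) = 𝟙{i''=i}(-1)^{#back}𝟙{cnt(α'') ≤ count(α)}∏_j binom(v_j-back_j, α_j-cnt_j)`. [folklore] -/
theorem rowC_offsetPtZ_binomTF (a : TorusSite d M) (v : Fin d → ℤ) (c'' : Fin n × List (Fin d × Bool))
    (c : Fin n × List (Fin d)) (hv : ∀ j, 2 * (|v j| + c''.2.length) < M) :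
    rowC (offsetPtZ a v) c'' (binomTF a c) =
      if c''.1 = c.1 then sgnB c''.2 * (if ∀ j, axisCnt c''.2 j ≤ c.2.count j then
        ∏ j : Fin d, ((Ring.choose (v j - backCnt c''.2 j) (c.2.count j - axisCnt c''.2 j) : ℤ) : ℝ) else 0)
      else 0 := by
  unfold rowC binomTF
  simp only []
  by_cases hi : c''.1 = c.1
  · simp only [hi, if_true]
    exact fdiffs_multiBinomZ a (fun j => c.2.count j) c''.2 v hv
  · rw [if_neg hi]
    have hfun : (fun x : TorusSite d M => if c''.1 = c.1 then
        ∏ j : Fin d, ((Ring.choose (coord a x j) (c.2.count j) : ℤ) : ℝ) else 0) = fun _ => 0 := by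
      funext x; rw [if_neg hi]
    rw [hfun, fdiffs_zero]

omit [NeZero M] in
/-- The total order `Σ_j cnt_j(α) = |α|`. [folklore] -/
theorem sum_axisCnt (α : List (Fin d × Bool)) : ∑ j, axisCnt α j = α.length := by
  have h := Multiset.sum_count_eq_card (s := (Finset.univ : Finset (Fin d)))
    (m := ((α.map Prod.fst : List (Fin d)) : Multiset (Fin d))) (fun _ _ => Finset.mem_univ _)
  simp only [Multiset.coe_count, Multiset.coe_card, List.length_map] at h
  simpa [axisCnt] using h

omit [NeZero M] in
/-- `Σ_j count_j(α) = |α|` for a list of directions. [folklore] -/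
theorem sum_count_dir (α : List (Fin d)) : ∑ j, α.count j = α.length := by
  have h := Multiset.sum_count_eq_card (s := (Finset.univ : Finset (Fin d)))
    (m := ((α : List (Fin d)) : Multiset (Fin d))) (fun _ _ => Finset.mem_univ _)
  simpa [Multiset.coe_count] using h

/-- The class of a signed factor: the component and the multiset of AXES of its steps. [folklore] -/
def clsS (c'' : Fin n × List (Fin d × Bool)) : Fin n × Multiset (Fin d) :=
  (c''.1, ((c''.2.map Prod.fst : List (Fin d)) : Multiset (Fin d)))

omit [NeZero M] in
/-- The class of a forward factor viewed as a signed one. [folklore] -/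
@[simp] theorem clsS_fwd (c : Fin n × List (Fin d)) : clsS (fwd c) = cls c := by
  simp [clsS, fwd, cls, Function.comp_def]

omit [NeZero M] in
/-- Equal classes force equal orders. [folklore] -/
theorem length_eq_of_clsS_eq_cls {c'' : Fin n × List (Fin d × Bool)} {c : Fin n × List (Fin d)}
    (h : clsS c'' = cls c) : c''.2.length = c.2.length := by
  have h2 := congrArg (fun q => Multiset.card q.2) h
  simpa [clsS, cls] using h2

/-- **(E1) More derivatives than polynomial degree**: `r^{(x)}_{c''}(b_c) = 0` if `|α''| > |α|`. [folklore] -/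
theorem rowC_offsetPtZ_binomTF_eq_zero_of_lt (a : TorusSite d M) (v : Fin d → ℤ)
    (c'' : Fin n × List (Fin d × Bool)) (c : Fin n × List (Fin d))
    (hv : ∀ j, 2 * (|v j| + c''.2.length) < M) (hlt : c.2.length < c''.2.length) :
    rowC (offsetPtZ a v) c'' (binomTF a c) = 0 := by
  rw [rowC_offsetPtZ_binomTF a v c'' c hv]
  split_ifs with hi hcond
  · exfalso
    have h1 := Finset.sum_le_sum fun j (_ : j ∈ Finset.univ) => hcond j
    rw [sum_axisCnt, sum_count_dir] at h1
    omega
  · rw [mul_zero]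
  · rfl

/-- **(E2) Equal orders**: `r^{(x)}_{c''}(b_c) = (-1)^{#back} 𝟙{clsS c'' = cls c}` if `|α''| = |α|` —
independent of the point `x` of the patch. [folklore] -/
theorem rowC_offsetPtZ_binomTF_of_eq (a : TorusSite d M) (v : Fin d → ℤ)
    (c'' : Fin n × List (Fin d × Bool)) (c : Fin n × List (Fin d))
    (hv : ∀ j, 2 * (|v j| + c''.2.length) < M) (heq : c''.2.length = c.2.length) :
    rowC (offsetPtZ a v) c'' (binomTF a c) = sgnB c''.2 * (if clsS c'' = cls c then 1 else 0) := by
  rw [rowC_offsetPtZ_binomTF a v c'' c hv]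
  by_cases hi : c''.1 = c.1
  · rw [if_pos hi]
    congr 1
    by_cases hcond : ∀ j, axisCnt c''.2 j ≤ c.2.count j
    · rw [if_pos hcond]
      -- pointwise `≤` with equal sums forces equality
      have hall : ∀ j, axisCnt c''.2 j = c.2.count j := by
        by_contra hne
        simp only [not_forall] at hne
        obtain ⟨j₁, hj₁⟩ := hne
        have hlt : axisCnt c''.2 j₁ < c.2.count j₁ := lt_of_le_of_ne (hcond j₁) hj₁
        have h1 := Finset.sum_lt_sum (fun j (_ : j ∈ Finset.univ) => hcond j) ⟨j₁, Finset.mem_univ _, hlt⟩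
        rw [sum_axisCnt, sum_count_dir] at h1
        omega
      have hcls : clsS c'' = cls c := by
        simp only [clsS, cls, Prod.mk.injEq]
        refine ⟨hi, Multiset.ext.2 fun j => ?_⟩
        simpa [Multiset.coe_count, axisCnt] using hall j
      rw [if_pos hcls]
      refine Finset.prod_eq_one fun j _ => ?_
      rw [hall j, Nat.sub_self]
      simp
    · rw [if_neg hcond]
      have hcls : clsS c'' ≠ cls c := by
        intro h
        apply hcond
        intro j
        have h2 := congrArg (fun q => Multiset.count j q.2) h
        simp only [clsS, cls, Multiset.coe_count] at h2
        simp only [axisCnt, h2, le_refl]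
      rw [if_neg hcls]
  · rw [if_neg hi]
    have hcls : clsS c'' ≠ cls c := fun h => hi (congrArg Prod.fst h)
    rw [if_neg hcls, mul_zero]

/-- The total order `Σ_k |α_k|` of a signed index sequence. [folklore] -/
def tordS (m'' : List (Fin n × List (Fin d × Bool))) : ℕ := (m''.map fun c => c.2.length).sum

/-- The total order `Σ_k |α_k|` of a forward index sequence. [folklore] -/
def tordF (m : List (Fin n × List (Fin d))) : ℕ := (m.map fun c => c.2.length).sum

/-- The sign `∏_k (-1)^{#back(α_k)}` of a signed index sequence. [folklore] -/
def sgnM (m'' : List (Fin n × List (Fin d × Bool))) : ℝ := (m''.map fun c => sgnB c.2).prod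

/-- The pattern permanent between a signed and a forward index sequence (classes by axes). [folklore] -/
def pcountS : List (Fin n × List (Fin d × Bool)) → List (Fin n × List (Fin d)) → ℝ
  | [], [] => 1
  | [], _ :: _ => 0
  | c'' :: rs, m => ∑ k ∈ range m.length,
      (if clsS c'' = cls (m.getD k (c''.1, [])) then 1 else 0) * pcountS rs (m.eraseIdx k)

omit [NeZero M] in
/-- Erasing the `k`-th factor lowers the total order by its order. [folklore] -/
theorem tordF_eraseIdx_add (m : List (Fin n × List (Fin d))) {k : ℕ} (hk : k < m.length)
    (c₀ : Fin n × List (Fin d)) : tordF (m.eraseIdx k) + (m.getD k c₀).2.length = tordF m := by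
  induction m generalizing k with
  | nil => simp at hk
  | cons c m ih =>
      cases k with
      | zero => simp [tordF, add_comm]
      | succ k =>
          simp only [List.eraseIdx_cons_succ, List.getD_cons_succ, tordF, List.map_cons, List.sum_cons] at ih ⊢
          have := ih (k := k) (by simpa using hk)
          omega

/-- **(L-A) The permanent vanishes when the monomial carries more derivatives than the test
polynomial has degree**: `tord(m'') > tord(m) ⇒ perm(r^{(x)}_{c''_k}(b_{c_j})) = 0`. [folklore] -/
theorem lperm_offsetPtZ_eq_zero_of_lt (a : TorusSite d M) (v : Fin d → ℤ) :
    ∀ (m'' : List (Fin n × List (Fin d × Bool))) (m : List (Fin n × List (Fin d))),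
    (∀ c'' ∈ m'', ∀ j, 2 * (|v j| + c''.2.length) < M) → tordF m < tordS m'' →
    lperm (m''.map (rowC (offsetPtZ a v))) (m.map (binomTF a)) = 0
  | [], m, _, h => by simp [tordS] at h
  | c'' :: rs, m, hv, h => by
      rw [List.map_cons, lperm_cons, List.length_map]
      refine Finset.sum_eq_zero fun k hk => ?_
      rw [Finset.mem_range] at hk
      rw [List.eraseIdx_map, List.getD_eq_getElem _ _ (by simpa using hk), List.getElem_map,
        ← List.getD_eq_getElem m (c''.1, []) hk]
      by_cases hlt : (m.getD k (c''.1, [])).2.length < c''.2.length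
      · rw [rowC_offsetPtZ_binomTF_eq_zero_of_lt a v c'' _ (hv c'' List.mem_cons_self) hlt, zero_mul]
      · rw [lperm_offsetPtZ_eq_zero_of_lt a v rs (m.eraseIdx k)
          (fun c hc => hv c (List.mem_cons_of_mem _ hc)) ?_, mul_zero]
        have h1 := tordF_eraseIdx_add m hk (c''.1, [])
        simp only [tordS, List.map_cons, List.sum_cons] at h ⊢
        omega

/-- **(L-B) Equal total orders**: `perm(r^{(x)}_{c''_k}(b_{c_j})) = sgn(m'')·pcountS(m'', m)`,
independent of the point `x` of the patch. [folklore] -/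
theorem lperm_offsetPtZ_of_eq (a : TorusSite d M) (v : Fin d → ℤ) :
    ∀ (m'' : List (Fin n × List (Fin d × Bool))) (m : List (Fin n × List (Fin d))),
    (∀ c'' ∈ m'', ∀ j, 2 * (|v j| + c''.2.length) < M) → tordS m'' = tordF m →
    lperm (m''.map (rowC (offsetPtZ a v))) (m.map (binomTF a)) = sgnM m'' * pcountS m'' m
  | [], [], _, _ => by simp [sgnM, pcountS]
  | [], _ :: _, _, _ => by simp [lperm, pcountS]
  | c'' :: rs, m, hv, h => by
      rw [List.map_cons, lperm_cons, List.length_map]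
      simp only [pcountS, sgnM, List.map_cons, List.prod_cons, Finset.mul_sum]
      refine Finset.sum_congr rfl fun k hk => ?_
      rw [Finset.mem_range] at hk
      rw [List.eraseIdx_map, List.getD_eq_getElem _ _ (by simpa using hk), List.getElem_map,
        ← List.getD_eq_getElem m (c''.1, []) hk]
      have h1 := tordF_eraseIdx_add m hk (c''.1, [])
      simp only [tordS, List.map_cons, List.sum_cons] at h
      rcases lt_trichotomy (m.getD k (c''.1, [])).2.length c''.2.length with hlt | heq | hgt
      · -- more derivatives than degree in the factor: both sides vanish
        rw [rowC_offsetPtZ_binomTF_eq_zero_of_lt a v c'' _ (hv c'' List.mem_cons_self) hlt, zero_mul]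
        have hne : clsS c'' ≠ cls (m.getD k (c''.1, [])) := fun h' => by
          have := length_eq_of_clsS_eq_cls h'; omega
        rw [if_neg hne]; ring
      · rw [rowC_offsetPtZ_binomTF_of_eq a v c'' _ (hv c'' List.mem_cons_self) heq.symm,
          lperm_offsetPtZ_of_eq a v rs (m.eraseIdx k) (fun c hc => hv c (List.mem_cons_of_mem _ hc))
            (by unfold tordS; omega)]
        simp only [sgnM]
        ring
      · -- fewer derivatives in the factor: the rest carries too many
        rw [lperm_offsetPtZ_eq_zero_of_lt a v rs (m.eraseIdx k)
          (fun c hc => hv c (List.mem_cons_of_mem _ hc)) (by unfold tordS; omega), mul_zero]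
        have hne : clsS c'' ≠ cls (m.getD k (c''.1, [])) := fun h' => by
          have := length_eq_of_clsS_eq_cls h'; omega
        rw [if_neg hne]; ring

/-! ### Pairings of monomials at a point of the patch with the binomial test functions -/

/-- **Triangularity kernel (A)**: `⟨M_{m'',x}, b_m^{(a)}⟩_0 = 0` when `m''` carries more
derivatives than `m` — the vanishing of `⟨(𝒫_t part)(X), f_m^{(a)}⟩_0` in the proof of
Lemma 2.1.5 of [BS-rg-loc]. [cite: BrydgesSlade2015RGII, Lemma 2.1.5 (proof: "B_{m',m} = |X|δ_{m',m} for [M_{m'}] ≥ [M_m]")] -/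
theorem TphiPairing_monomial_offsetPtZ_eq_zero {pN : ℕ} (hpN : 1 ≤ pN) (a : TorusSite d M) (v : Fin d → ℤ)
    (m'' : List (Fin n × List (Fin d × Bool))) (m : List (Fin n × List (Fin d)))
    (hv : ∀ c'' ∈ m'', ∀ j, 2 * (|v j| + c''.2.length) < M) (hp : m.length ≤ pN)
    (h : tordF m < tordS m'') :
    TphiPairing pN (basisDir d M n) (monomial m'' (offsetPtZ a v)) 0 (tensorTF (m.map (binomTF a))) = 0 := by
  by_cases hlen : m''.length = m.length
  · rw [TphiPairing_monomial_tensorTF hpN _ m'' _ (by simpa using hlen) (by simpa using hp),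
      lperm_offsetPtZ_eq_zero_of_lt a v m'' m hv h, mul_zero]
  · have hc := TphiPairing_monomial_zero_congr pN m'' (offsetPtZ a v) (g := tensorTF (m.map (binomTF a)))
      (g' := fun _ => 0) (fun w hw => tensorTF_eq_zero_of_length _ w (by simp; omega))
    unfold TphiPairing at hc ⊢
    rw [hc, pairing_zero_right]

/-- **Triangularity kernel (B)**: for equal total orders and degrees,
`⟨M_{m'',x}, b_m^{(a)}⟩_0 = (1/p!)·sgn(m'')·pcountS(m'',m)`, independent of `x` — the diagonal
computation in the proof of Lemma 2.1.5 of [BS-rg-loc]. [cite: BrydgesSlade2015RGII, Lemma 2.1.5 (proof)] -/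
theorem TphiPairing_monomial_offsetPtZ_of_eq {pN : ℕ} (hpN : 1 ≤ pN) (a : TorusSite d M) (v : Fin d → ℤ)
    (m'' : List (Fin n × List (Fin d × Bool))) (m : List (Fin n × List (Fin d)))
    (hv : ∀ c'' ∈ m'', ∀ j, 2 * (|v j| + c''.2.length) < M) (hp : m.length ≤ pN)
    (hlen : m''.length = m.length) (h : tordS m'' = tordF m) :
    TphiPairing pN (basisDir d M n) (monomial m'' (offsetPtZ a v)) 0 (tensorTF (m.map (binomTF a))) =
      ((m.length.factorial : ℕ) : ℝ)⁻¹ * (sgnM m'' * pcountS m'' m) := by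
  rw [TphiPairing_monomial_tensorTF hpN _ m'' _ (by simpa using hlen) (by simpa using hp),
    lperm_offsetPtZ_of_eq a v m'' m hv h, List.length_map]

omit [NeZero M] in
/-- On forward sequences the signed pattern permanent is the pattern permanent. [folklore] -/
theorem pcountS_fwd : ∀ (m' m : List (Fin n × List (Fin d))), pcountS (m'.map fwd) m = pcount m' m
  | [], [] => rfl
  | [], _ :: _ => rfl
  | c :: m', m => by
      rw [List.map_cons]
      simp only [pcountS, pcount, clsS_fwd]
      refine Finset.sum_congr rfl fun k hk => ?_
      rw [Finset.mem_range] at hk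
      rw [pcountS_fwd m' (m.eraseIdx k), List.getD_eq_getElem _ _ hk, List.getD_eq_getElem _ _ hk]

end Loc

end LongRangePhi4

end Literature.Barriers.CriticalPhenomena

end
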